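import Summits.Ventures.AbcSig.Rows.StatementsC1b
import Summits.Ventures.AbcSig.Rows.XnYn15Z2EvenV2X

/-!
# Venture AbcSig — CELL bridge for `xⁿ + yⁿ = 15 z²` (`xy` even): p1's census predicate `Rows.C1CellEven 15 11 ∅`

HONEST FRAMING. COMPUTATION cell `pub-abcsig`; CONDITIONAL theorem; no claim on ABC or any summit. Hypotheses exactly
those of `Rows/XnYn15Z2EvenV2X.lean` (`xrow_XnYn15Z2EvenV2`): `BS04Package` (CITED), `DataComplete` / `RefinesCPSymAll` (COMPUTED,
certified engine level files; norm-form certificates `Sieve/CharpolyCert.lean`), and the row's per-orbit CITED exclusions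
`hX_…` universally quantified in the exponent. Conclusion = p1's statement of the SIGNED row of record
`census/rows/C1/C1-C15-all.md` (sha16 `b2613d49164632d6`) in the census vocabulary
(`Rows/Statements.lean`, `Rows/StatementsC1b.lean`). GENERATED by p-lean g4 `gen4/cprow.py` (pattern of `Rows/XnYn14Z2XCell.lean`).
-/

namespace Summit.Ventures.AbcSig

/-- `xⁿ + yⁿ = 15 z²` (`xy` even): p1's `Rows.C1CellEven 15 11 ∅` from `xrow_XnYn15Z2EvenV2` (hypotheses as there, `hX_…` for every exponent). -/
theorem C1CellEven_15_v2_of (M : NewformModel) (hP : M.BS04Package)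
    (hD450 : M.DataComplete 450 level450Orbits)
    (hX_orbit_450_1 : ∀ n : ℕ, M.Excludes 450 orbit_450_1 (fun S => S.A = 1 ∧ S.B = 1 ∧ S.C = 15 ∧ S.n = n ∧ 2 ∣ S.a * S.b))
    (hX_orbit_450_2 : ∀ n : ℕ, n ∈ ([11] : List ℕ) → M.Excludes 450 orbit_450_2 (fun S => S.A = 1 ∧ S.B = 1 ∧ S.C = 15 ∧ S.n = n ∧ 2 ∣ S.a * S.b))
    (hX_orbit_450_3 : ∀ n : ℕ, M.Excludes 450 orbit_450_3 (fun S => S.A = 1 ∧ S.B = 1 ∧ S.C = 15 ∧ S.n = n ∧ 2 ∣ S.a * S.b))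
    (hX_orbit_450_4 : ∀ n : ℕ, M.Excludes 450 orbit_450_4 (fun S => S.A = 1 ∧ S.B = 1 ∧ S.C = 15 ∧ S.n = n ∧ 2 ∣ S.a * S.b))
    (hX_orbit_450_5 : ∀ n : ℕ, n ∈ ([11] : List ℕ) → M.Excludes 450 orbit_450_5 (fun S => S.A = 1 ∧ S.B = 1 ∧ S.C = 15 ∧ S.n = n ∧ 2 ∣ S.a * S.b))
    (hX_orbit_450_6 : ∀ n : ℕ, M.Excludes 450 orbit_450_6 (fun S => S.A = 1 ∧ S.B = 1 ∧ S.C = 15 ∧ S.n = n ∧ 2 ∣ S.a * S.b))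
    (hX_orbit_450_7 : ∀ n : ℕ, M.Excludes 450 orbit_450_7 (fun S => S.A = 1 ∧ S.B = 1 ∧ S.C = 15 ∧ S.n = n ∧ 2 ∣ S.a * S.b)) :
    Rows.C1CellEven 15 11 ∅ := by
  intro n hn h11 hC _ x y z hpar
  exact xrow_XnYn15Z2EvenV2 M hP hD450 n hn h11  hC (hX_orbit_450_1 n) (hX_orbit_450_2 n) (hX_orbit_450_3 n) (hX_orbit_450_4 n) (hX_orbit_450_5 n) (hX_orbit_450_6 n) (hX_orbit_450_7 n) x y z hpar

end Summit.Ventures.AbcSig
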